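import Summits.QuantumFields.YangMills.Theorems.PoincareLipschitzRegaugedTowerStep
import HarnessLib

/-!
# Crux stmt-QuantumFields-19936 `HistoryTailL`, K2 at depth (route crux `BlockLipschitzL`, stmt-QuantumFields-23533), K2 supplier plan F6 — step 1:
# THE RE-GAUGED LEVEL STEP WITH THE WALK MASS DECOUPLED FROM THE `ℓ²` DATUM

w2 g10's ✓`PoincareLipschitzRegaugedTowerStep.exists_regauge_sum_normSq_le` (F5b-3) feeds the one-step guards (`72m ≤ 1`, `3m + α < δ_2`) and the slope of
the second-order terms with the SAME letter `C₁·M` that bounds the `ℓ²(S)` datum `M` through Cauchy–Schwarz on the two-block neighbourhood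
(✓`nbhdMass_le_of_sq_sum_le`) — which is what confines the knit ✓p686808 to the SMALL-DATA regime `144·C₁·X ≤ 1`.  For F6 («hStab on the
annulus») the per-bond WALK MASS `m(c) = (d+2)L·Σ_{N(c)}‖Y‖` is to be supplied INDEPENDENTLY — by the covariant interior mean-value row (R3)-COV at the
re-minimised (Coulomb) representative — while the `ℓ²` bookkeeping keeps `M`.  THIS FILE re-reads F5b-3 with the mass bound as a DISPLAYED letter:
`exists_regauge_sum_normSq_le_of_mass … (hmass : ∀ c ∈ T, (d+2)L·Σ_{N(c)}‖pertVar V W‖ ≤ ms) (hms72 : 72·ms ≤ 1) (hmsN : 3ms + α < δ_2) … :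
∃ g, Σ_{c∈T}‖pertVar (Ū V) ((Ū W)^g) c‖² ≤ ((ρ + κ·(159α + 520·ms))·M)²` — proof = w2's, verbatim after the point where the mass bound is established
(the Minkowski∕ROW-L∕ROW-M `ℓ²` half is unchanged and still reads `M`).  F5b-3 is the case `ms := C₁·M`.

HONEST: bookkeeping re-read of a landed theorem; nothing of hStab on the annulus, (R3)-COV, `BlockLipschitzL`, `HistoryTailL`, rung R3 (YM₃ on T³ —
not d = 4, not Clay) or a summit statement is proved.  LEAD seat ym-ust-19936-w1 g7 (cell ym3-torus), `--supports stmt-QuantumFields-23533`.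
-/

noncomputable section

open scoped BigOperators Matrix.Norms.L2Operator
open NormedSpace

namespace Summit.QuantumFields.YangMills.Theorems.PoincareLipschitzRegaugedTowerStepMass

open Literature.MathematicalPhysics.QuantumFieldTheory.Balaban1983to89
open Finset T4Continuum BlockAveraging AveragingRT ExpMeanLog BlockAveragingEMLLinearised BlockAveragingEMLLinearisedBackground BlockAveragingEMLProp2
open Summit.QuantumFields.YangMills.Theorems.PoincareLipschitzRegaugedStep (norm_pertVar_avgFun_regauged_le_nbhdMass)
open Summit.QuantumFields.YangMills.Theorems.PoincareLipschitzSkewProjection (norm_combMean_skewPart_sub_le_nbhdMass su_combMean_skewPart)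
open Summit.QuantumFields.YangMills.Theorems.PoincareLipschitzRegaugeAbsorption (exists_gaugeTransf_coe_eq_exp_neg)
open Summit.QuantumFields.YangMills.Theorems.Prop7FibreRemainderL1Level (nbhdMass_sq_le)
open Summit.QuantumFields.YangMills.Theorems.Prop7TrueLinIterDefect (sqrt_sum_norm_add_sq_le)
open Summit.QuantumFields.YangMills.Theorems.PoincareLipschitzRegaugedTowerStep (remainder_le_linear sum_sq_le_sq_add)

variable {P : Params} {j : ℕ}

/-- ★★★ **ONE LEVEL OF THE RE-GAUGED NONLINEAR TOWER IN `ℓ²`, WALK MASS DISPLAYED.**  As ✓`exists_regauge_sum_normSq_le` (F5b-3) but with the per-bond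
two-block mass bound `(d+2)L·Σ_{N(c)}‖pertVar V W‖ ≤ ms` (`c ∈ T`) a HYPOTHESIS, `0 ≤ ms`, `72·ms ≤ 1`, `3ms + α < δ_2`; conclusion
`∃ g, Σ_{c∈T}‖pertVar (avgFun ℰ V) (gaugeAct g (avgFun ℰ W)) c‖² ≤ ((ρ + κ·(159α + 520·ms))·M)²` (the closure hypothesis `hS` of F5b-3 is
no longer needed: it only fed the mass bound). [cite: Balaban1985Averaging, Prop. 3 (122)-(126) p.36, §3 (156)-(163)] -/
theorem exists_regauge_sum_normSq_le_of_mass (hj : j + 1 ≤ P.m + P.K) (V W : GaugeField P j (Matrix.specialUnitaryGroup (Fin 2) ℂ))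
    (T : Finset (PBond P (j + 1))) (S : Finset (PBond P j))
    {M α : ℝ} (hM0 : 0 ≤ M) (hM : ∑ b ∈ S, ‖pertVar V W b‖ ^ 2 ≤ M ^ 2)
    (hα0 : 0 ≤ α) (hα : ∀ c ∈ T, ∀ i : Idx P, dist1 (loopHol V c i) ≤ α) (hα24 : α ≤ 1 / 24)
    {ms : ℝ} (hms0 : 0 ≤ ms)
    (hmass : ∀ c ∈ T, (((P.d + 2) * P.L : ℕ) : ℝ) *
      ∑ b ∈ univ.filter (fun b : PBond P j => blockOf b.src = c.src ∨ blockOf b.src = c.tgt), ‖pertVar V W b‖ ≤ ms)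
    (hms72 : 72 * ms ≤ 1) (hmsN : 3 * ms + α < deltaSU (Fin 2))
    (hRowL : ∑ c ∈ T, ‖((Fintype.card (Idx P) : ℂ))⁻¹ • ∑ i : Idx P,
        ((holAt V (walk (emb c.src) (stairWord i.2.1 (off i.1))) : Matrix.specialUnitaryGroup (Fin 2) ℂ) : Matrix (Fin 2) (Fin 2) ℂ) *
          covWalkSum V (pertVar V W) (walk (walkEnd (emb c.src) (stairWord i.2.1 (off i.1))) (List.replicate P.L (c.dir, true))) *
        star ((holAt V (walk (emb c.src) (stairWord i.2.1 (off i.1))) : Matrix.specialUnitaryGroup (Fin 2) ℂ) : Matrix (Fin 2) (Fin 2) ℂ)‖ ^ 2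
      ≤ ((P.L : ℝ) ^ P.d)⁻¹ * (P.L : ℝ) ^ 2 * ∑ b ∈ S, ‖pertVar V W b‖ ^ 2)
    (hRowM : ∀ g : PBond P j → ℝ, (∀ b, 0 ≤ g b) →
      ∑ c ∈ T, ∑ b ∈ univ.filter (fun b : PBond P j => blockOf b.src = c.src ∨ blockOf b.src = c.tgt), g b ≤ 2 * P.d * ∑ b ∈ S, g b) :
    ∃ g : GaugeTransf P (j + 1) (Matrix.specialUnitaryGroup (Fin 2) ℂ),
      ∑ c ∈ T, ‖pertVar (avgFun (expMeanLogSU (n := Fin 2)) V) (GaugeField.gaugeAct g (avgFun (expMeanLogSU (n := Fin 2)) W)) c‖ ^ 2 ≤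
        ((Real.sqrt (((P.L : ℝ) ^ P.d)⁻¹ * (P.L : ℝ) ^ 2)
          + (((P.d + 2) * P.L : ℕ) : ℝ) * Real.sqrt (2 * P.d * (P.L : ℝ) ^ P.d * (2 * P.d))
            * (159 * α + 520 * ms)) * M) ^ 2 := by
  -- letters
  set Y : PBond P j → Matrix (Fin 2) (Fin 2) ℂ := pertVar V W with hYdef
  set Z : PBond P j → Matrix (Fin 2) (Fin 2) ℂ := fun b => (2 : ℂ)⁻¹ • (pertVar V W b - star (pertVar V W b)) with hZdef
  set ξ : Site P (j + 1) → Matrix (Fin 2) (Fin 2) ℂ := fun y =>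
    ((Fintype.card (Idx P) : ℂ))⁻¹ • ∑ i : Idx P, covWalkSum V Z (walk (emb y) (stairWord i.2.1 (off i.1))) with hξdef
  set ℓ : ℝ := (((P.d + 2) * P.L : ℕ) : ℝ) with hℓ
  set ρ : ℝ := Real.sqrt (((P.L : ℝ) ^ P.d)⁻¹ * (P.L : ℝ) ^ 2) with hρ
  set κ : ℝ := ℓ * Real.sqrt (2 * P.d * (P.L : ℝ) ^ P.d * (2 * P.d)) with hκ
  set q : ℝ := 159 * α + 520 * ms with hq
  have hℓ0 : 0 ≤ ℓ := by positivity
  have hq0 : 0 ≤ q := by positivity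
  have hρ0 : 0 ≤ ρ := Real.sqrt_nonneg _
  have hκ0 : 0 ≤ κ := by positivity
  -- the gauge transformation `g = exp(−ξ)`
  have hξsu : ∀ y, star (ξ y) = -ξ y ∧ (ξ y).trace = 0 := fun y => su_combMean_skewPart V W y
  obtain ⟨g, hg⟩ := exists_gaugeTransf_coe_eq_exp_neg ξ hξsu
  refine ⟨g, ?_⟩
  -- the two-block mass `m(c) = ℓ·S(c)` and its bound `≤ ms` on `T`
  set Sm : PBond P (j + 1) → ℝ := fun c => ∑ b ∈ univ.filter (fun b : PBond P j => blockOf b.src = c.src ∨ blockOf b.src = c.tgt), ‖Y b‖ with hSm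
  have hSm0 : ∀ c, 0 ≤ Sm c := fun c => Finset.sum_nonneg fun _ _ => norm_nonneg _
  have hmc : ∀ c ∈ T, ℓ * Sm c ≤ ms := fun c hc => by
    simpa only [hℓ, hSm, hYdef] using hmass c hc
  -- pointwise: the re-gauged ratio at `c ∈ T`
  set LINE : PBond P (j + 1) → Matrix (Fin 2) (Fin 2) ℂ := fun c => ((Fintype.card (Idx P) : ℂ))⁻¹ • ∑ i : Idx P,
        ((holAt V (walk (emb c.src) (stairWord i.2.1 (off i.1))) : Matrix.specialUnitaryGroup (Fin 2) ℂ) : Matrix (Fin 2) (Fin 2) ℂ) *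
          covWalkSum V Y (walk (walkEnd (emb c.src) (stairWord i.2.1 (off i.1))) (List.replicate P.L (c.dir, true))) *
        star ((holAt V (walk (emb c.src) (stairWord i.2.1 (off i.1))) : Matrix.specialUnitaryGroup (Fin 2) ℂ) : Matrix (Fin 2) (Fin 2) ℂ)
    with hLINE
  have hpt : ∀ c ∈ T,
      ‖pertVar (avgFun (expMeanLogSU (n := Fin 2)) V) (GaugeField.gaugeAct g (avgFun (expMeanLogSU (n := Fin 2)) W)) c‖
        ≤ ‖LINE c‖ + q * (ℓ * Sm c) := by
    intro c hc
    have hm := hmc c hc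
    have hm0 : 0 ≤ ℓ * Sm c := mul_nonneg hℓ0 (hSm0 c)
    have hm72 : 72 * (ℓ * Sm c) ≤ 1 := by nlinarith
    have hmN : 3 * (ℓ * Sm c) + α < deltaSU (Fin 2) := by linarith
    have hδm := norm_combMean_skewPart_sub_le_nbhdMass hj V W c c.src (Or.inl rfl)
    have hδp := norm_combMean_skewPart_sub_le_nbhdMass hj V W c c.tgt (Or.inr rfl)
    have hmδ : ℓ * Sm c + (ℓ * Sm c) ^ 2 / 2 ≤ 1 := by nlinarith
    have h := norm_pertVar_avgFun_regauged_le_nbhdMass hj V W c (δ := (ℓ * Sm c) ^ 2 / 2)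
      (by simpa only [hℓ, hSm, hYdef] using hm72) (hα c hc) hα24 (by simpa only [hℓ, hSm, hYdef] using hmN)
      (by simpa only [hℓ, hSm, hYdef, hξdef, hZdef] using hδm) (by simpa only [hℓ, hSm, hYdef, hξdef, hZdef] using hδp)
      (by simpa only [hℓ, hSm, hYdef] using hmδ) g (hg c.src) (hg c.tgt)
    have hrem := remainder_le_linear hm0 hm hms72 hα0 hα24
    have h' : ‖pertVar (avgFun (expMeanLogSU (n := Fin 2)) V) (GaugeField.gaugeAct g (avgFun (expMeanLogSU (n := Fin 2)) W)) c‖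
        ≤ ‖LINE c‖ + (159 * α * (ℓ * Sm c) + 260 * (ℓ * Sm c) ^ 2 + 2 * ((ℓ * Sm c) ^ 2 / 2)
          + 8 * (ℓ * Sm c + (ℓ * Sm c) ^ 2 / 2) * (3 * (ℓ * Sm c) + 159 * α * (ℓ * Sm c) + 260 * (ℓ * Sm c) ^ 2
            + (ℓ * Sm c + (ℓ * Sm c) ^ 2 / 2))) := by
      have e := h
      simp only [hℓ, hSm, hYdef, hLINE] at e ⊢
      linarith
    linarith
  -- `ℓ²(T)`: Minkowski with ROW-L and ROW-M
  have hLINE_sq : ∑ c ∈ T, ‖LINE c‖ ^ 2 ≤ (ρ * M) ^ 2 := by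
    have h1 : ∑ c ∈ T, ‖LINE c‖ ^ 2 ≤ ((P.L : ℝ) ^ P.d)⁻¹ * (P.L : ℝ) ^ 2 * ∑ b ∈ S, ‖Y b‖ ^ 2 := by
      simpa only [hLINE, hYdef] using hRowL
    have hc0 : (0 : ℝ) ≤ ((P.L : ℝ) ^ P.d)⁻¹ * (P.L : ℝ) ^ 2 := by positivity
    rw [mul_pow, hρ, Real.sq_sqrt hc0]
    exact h1.trans (mul_le_mul_of_nonneg_left hM hc0)
  have hmass_sq : ∑ c ∈ T, (q * (ℓ * Sm c)) ^ 2 ≤ (κ * q * M) ^ 2 := by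
    -- `Σ_T (ℓ S(c))² ≤ ℓ²·(2dL^d)·Σ_T Σ_{N(c)} ‖Y‖² ≤ ℓ²·(2dL^d)(2d)·M²`
    have h1 : ∀ c ∈ T, (Sm c) ^ 2 ≤ (2 * P.d * (P.L : ℝ) ^ P.d) *
        ∑ b ∈ univ.filter (fun b : PBond P j => blockOf b.src = c.src ∨ blockOf b.src = c.tgt), ‖Y b‖ ^ 2 :=
      fun c _ => by simpa only [hSm] using nbhdMass_sq_le hj Y c
    have h2 := hRowM (fun b => ‖Y b‖ ^ 2) (fun b => sq_nonneg _)
    have hC : (0 : ℝ) ≤ 2 * P.d * (P.L : ℝ) ^ P.d := by positivity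
    have h3 : ∑ c ∈ T, (Sm c) ^ 2 ≤ (2 * P.d * (P.L : ℝ) ^ P.d) * (2 * P.d * ∑ b ∈ S, ‖Y b‖ ^ 2) := by
      calc ∑ c ∈ T, (Sm c) ^ 2 ≤ ∑ c ∈ T, (2 * P.d * (P.L : ℝ) ^ P.d) *
            ∑ b ∈ univ.filter (fun b : PBond P j => blockOf b.src = c.src ∨ blockOf b.src = c.tgt), ‖Y b‖ ^ 2 := Finset.sum_le_sum h1
        _ = (2 * P.d * (P.L : ℝ) ^ P.d) * ∑ c ∈ T,
            ∑ b ∈ univ.filter (fun b : PBond P j => blockOf b.src = c.src ∨ blockOf b.src = c.tgt), ‖Y b‖ ^ 2 := by rw [Finset.mul_sum]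
        _ ≤ (2 * P.d * (P.L : ℝ) ^ P.d) * (2 * P.d * ∑ b ∈ S, ‖Y b‖ ^ 2) := mul_le_mul_of_nonneg_left h2 hC
    have h4 : ∑ c ∈ T, (Sm c) ^ 2 ≤ (2 * P.d * (P.L : ℝ) ^ P.d * (2 * P.d)) * M ^ 2 := by
      have : (2 * P.d * (P.L : ℝ) ^ P.d) * (2 * P.d * ∑ b ∈ S, ‖Y b‖ ^ 2) ≤ (2 * P.d * (P.L : ℝ) ^ P.d * (2 * P.d)) * M ^ 2 := by
        have hd0 : (0 : ℝ) ≤ 2 * P.d := by positivity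
        nlinarith [mul_le_mul_of_nonneg_left hM (mul_nonneg hC hd0)]
      exact h3.trans this
    have e : ∑ c ∈ T, (q * (ℓ * Sm c)) ^ 2 = (q * ℓ) ^ 2 * ∑ c ∈ T, (Sm c) ^ 2 := by
      rw [Finset.mul_sum]; exact Finset.sum_congr rfl fun c _ => by ring
    have hK : (0 : ℝ) ≤ 2 * P.d * (P.L : ℝ) ^ P.d * (2 * P.d) := by positivity
    have hκ2 : κ ^ 2 = ℓ ^ 2 * (2 * P.d * (P.L : ℝ) ^ P.d * (2 * P.d)) := by rw [hκ, mul_pow, Real.sq_sqrt hK]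
    rw [e]
    calc (q * ℓ) ^ 2 * ∑ c ∈ T, (Sm c) ^ 2 ≤ (q * ℓ) ^ 2 * ((2 * P.d * (P.L : ℝ) ^ P.d * (2 * P.d)) * M ^ 2) :=
          mul_le_mul_of_nonneg_left h4 (sq_nonneg _)
      _ = (κ * q * M) ^ 2 := by rw [show (κ * q * M) ^ 2 = κ ^ 2 * (q ^ 2 * M ^ 2) by ring, hκ2]; ring
  have hmain := sum_sq_le_sq_add T (F := fun c =>
      ‖pertVar (avgFun (expMeanLogSU (n := Fin 2)) V) (GaugeField.gaugeAct g (avgFun (expMeanLogSU (n := Fin 2)) W)) c‖)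
    (a := fun c => ‖LINE c‖) (b := fun c => q * (ℓ * Sm c)) (A := ρ * M) (B := κ * q * M)
    (mul_nonneg hρ0 hM0) (by positivity) (fun c _ => norm_nonneg _) hpt hLINE_sq hmass_sq
  refine hmain.trans (le_of_eq ?_)
  simp only [hρ, hκ, hq, hℓ]
  ring


end Summit.QuantumFields.YangMills.Theorems.PoincareLipschitzRegaugedTowerStepMass

end
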